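import Literature.MathematicalPhysics.StatisticalMechanics.Crystallization
import Literature.Algebra.EuclideanLattices.IntegerBases
import HarnessLib

/-!
# Periodic configurations exist in every dimension: the integer lattice `ℤᵈ`

Topic: `Literature/MathematicalPhysics/StatisticalMechanics`. Carrier witness (libB carrier census,
D-0034) for the structure `PeriodicConfiguration d` of `Crystallization.lean` — the type over which
the energetic form of the crystallization conjecture `HasPeriodicGroundStateEnergy V d`
(`∃ P, IsLeast (range e) (e P) ∧ …`) and the route items of `AtomisticToContinuum/Crystallization`
quantify (`⨅ Q : PeriodicConfiguration 3, e_LJ(Q)`, `∀ Q : PeriodicConfiguration 3, …`,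
`∃ Q : PeriodicConfiguration 3, …`).

## Content

* `integerLatticeConfiguration d : PeriodicConfiguration d` — the simple (hyper)cubic Bravais
  lattice `ℤᵈ ⊂ ℝᵈ`: lattice of periods `ℤᵈ = stdIntLattice d = span_ℤ {e₁, …, e_d}`
  (`Literature/Algebra/EuclideanLattices/IntegerBases.lean`; discreteness and full rank are
  Mathlib's `ZSpan` instances), one-point motif `F = {0}`. In the words of Blanc–Lewin 2015,
  §2.1: periodicity is invariance under a group `G = {∑ⱼ nⱼ vⱼ : nⱼ ∈ ℤ}` generated by `d`
  independent vectors (17); "in the special case where the particles are exactly on the nodes of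
  the lattice `G`", `μ = ∑_{g ∈ G} δ_{g+y}` (18), "we use the word Bravais lattice or mono-atomic
  lattice. For instance, in dimension 3, the simple cubic lattice (SC) … are all Bravais
  lattices."
* `integerLatticeConfiguration_points` (the point set `F + G` is `ℤᵈ`),
  `mem_points_integerLatticeConfiguration_iff` (points = vectors with integer coordinates),
  `energyPerParticle_integerLatticeConfiguration` (Blanc–Lewin (23): for a Bravais lattice
  `e(G) = ½ ∑_{g ∈ G ∖ {0}} V(|g|)`).
* `PeriodicConfiguration_nonempty : ∀ d, Nonempty (PeriodicConfiguration d)` — **the carrier is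
  inhabited at every parameter** `d : ℕ` (including `d = 0`, where `ℝ⁰ = {0} = ℤ⁰` and the
  configuration is the single point) — and the instances `PeriodicConfiguration.instInhabited`,
  `PeriodicConfiguration.instNonempty`, so that `⨅ Q : PeriodicConfiguration d, …`
  (`le_ciInf`, `exists_lt_of_ciInf_lt`), `Classical.arbitrary` and `default` are available in
  every dimension without a local `haveI`; `PeriodicConfiguration.le_ciInf_energyPerParticle` is
  the typical use.

## Sources

* X. Blanc, M. Lewin, *The crystallization conjecture: a review*, EMS Surv. Math. Sci. 2 (2015),
  255–306, arXiv:1504.01153: §2.1 (17)–(18) (periodic and Bravais configurations; SC is Bravais),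
  (23) (energy per particle of a Bravais lattice).
* D. Micciancio, S. Goldwasser, *Complexity of Lattice Problems* (2002), Ch. 1 §1 (`ℤⁿ` is a
  lattice) — through `stdIntLattice`.

## Design notes

* The tree already holds special inhabitants, all of this shape (a full-rank lattice with motif
  `{0}` or `{y}`): `intChain` (`d = 1`, `StickyChainCrystallization.lean`; it is
  `integerLatticeConfiguration 1` by `rfl`), `Literature.Barriers.AtomisticToContinuum.bravaisConfiguration B y`
  and `latticeConfiguration L` (barrier files; they take the lattice as input), the Barlow / hcp /
  fcc configurations of `BarlowStacking.lean` (`d = 3`) and `e8Configuration` (`d = 8`). This file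
  is the import-light, dimension-uniform witness: it imports only `Crystallization.lean` and
  `IntegerBases.lean`.
* `energyPerParticle` is a `tsum` (junk value `0` when the lattice sum diverges, see
  `Crystallization.lean`); `energyPerParticle_integerLatticeConfiguration` is an identity of
  `tsum`s and asserts no summability.
-/

noncomputable section

open scoped BigOperators

namespace Literature.MathematicalPhysics.StatisticalMechanics

open Literature.Algebra.EuclideanLattices

section IntegerLattice

variable (d : ℕ)

/-- **The integer lattice `ℤᵈ` as a periodic configuration** (the simple cubic Bravais lattice):
lattice of periods `ℤᵈ = stdIntLattice d`, motif `F = {0}` — the mono-atomic case `#F = 1`,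
`μ = ∑_{g ∈ G} δ_g`, of Blanc–Lewin's periodic configurations `F + G`; "the simple cubic lattice
(SC) … are all Bravais lattices". [cite: BlancLewin2015, §2.1 (17)–(18)] -/
def integerLatticeConfiguration : PeriodicConfiguration d where
  lattice := stdIntLattice d
  discrete := inferInstance
  isZLattice := inferInstance
  motif := {0}
  motif_nonempty := ⟨0, Finset.mem_singleton_self 0⟩
  eq_of_sub_mem := fun x hx y hy _ => by
    rw [Finset.mem_singleton.1 hx, Finset.mem_singleton.1 hy]

/-- The lattice of periods of the integer-lattice configuration is `ℤᵈ`. [folklore] -/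
@[simp] theorem integerLatticeConfiguration_lattice :
    (integerLatticeConfiguration d).lattice = stdIntLattice d := rfl

/-- The motif of the integer-lattice configuration is `{0}`. [folklore] -/
@[simp] theorem integerLatticeConfiguration_motif :
    (integerLatticeConfiguration d).motif = {0} := rfl

/-- One particle per cell: `#F = 1` (a Bravais, i.e. mono-atomic, lattice).
[cite: BlancLewin2015, §2.1 (18)] -/
@[simp] theorem card_motif_integerLatticeConfiguration :
    (integerLatticeConfiguration d).motif.card = 1 := rfl

/-- The point set `F + G = {0} + ℤᵈ` of the integer-lattice configuration is `ℤᵈ`. [folklore] -/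
theorem integerLatticeConfiguration_points :
    (integerLatticeConfiguration d).points = (stdIntLattice d : Set (EuclideanSpace ℝ (Fin d))) := by
  ext z
  simp only [PeriodicConfiguration.points, integerLatticeConfiguration_motif,
    integerLatticeConfiguration_lattice, Finset.mem_singleton, exists_eq_left, zero_add,
    Set.mem_setOf_eq, SetLike.mem_coe]
  constructor
  · rintro ⟨g, hg, rfl⟩
    exact hg
  · intro hz
    exact ⟨z, hz, rfl⟩

variable {d}

/-- The points of the integer-lattice configuration are exactly the vectors all of whose
coordinates are integers. [folklore] -/
theorem mem_points_integerLatticeConfiguration_iff {z : EuclideanSpace ℝ (Fin d)} :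
    z ∈ (integerLatticeConfiguration d).points ↔ ∀ j, ∃ k : ℤ, (k : ℝ) = z j := by
  rw [integerLatticeConfiguration_points, SetLike.mem_coe, mem_stdIntLattice_iff]

/-- The origin is a point of the integer-lattice configuration. [folklore] -/
theorem zero_mem_points_integerLatticeConfiguration :
    (0 : EuclideanSpace ℝ (Fin d)) ∈ (integerLatticeConfiguration d).points :=
  (integerLatticeConfiguration d).mem_points_of_mem_motif (Finset.mem_singleton_self 0)

/-- The standard basis vectors `eⱼ` are points of the integer-lattice configuration (so for
`d ≥ 1` it has points other than the origin, at distance `1` from it). [folklore] -/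
theorem single_mem_points_integerLatticeConfiguration (j : Fin d) :
    EuclideanSpace.single j (1 : ℝ) ∈ (integerLatticeConfiguration d).points := by
  rw [mem_points_integerLatticeConfiguration_iff]
  intro i
  by_cases h : i = j
  · exact ⟨1, by simp [h]⟩
  · exact ⟨0, by simp [h]⟩

variable (d)

/-- **Energy per particle of the Bravais lattice `ℤᵈ`**: `e(ℤᵈ) = ½ ∑_{g ∈ ℤᵈ ∖ {0}} V(|g|)`
(Blanc–Lewin 2015, (23), the case `F = {y}`); an identity of `tsum`s (both sides carry the same
junk value `0` if the lattice sum diverges). [cite: BlancLewin2015, §2.1 (23)] -/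
theorem energyPerParticle_integerLatticeConfiguration (V : ℝ → ℝ) :
    (integerLatticeConfiguration d).energyPerParticle V =
      2⁻¹ * ∑' g : {g : EuclideanSpace ℝ (Fin d) // g ∈ stdIntLattice d ∧ g ≠ 0}, V ‖g.1‖ := by
  have hset : {y : EuclideanSpace ℝ (Fin d) | y ∈ (integerLatticeConfiguration d).points ∧ y ≠ 0} =
      {g : EuclideanSpace ℝ (Fin d) | g ∈ stdIntLattice d ∧ g ≠ 0} := by
    rw [integerLatticeConfiguration_points]
    rfl
  unfold PeriodicConfiguration.energyPerParticle
  rw [integerLatticeConfiguration_motif, Finset.sum_singleton, Finset.card_singleton, Nat.cast_one,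
    mul_one]
  congr 1
  calc (∑' y : {y : EuclideanSpace ℝ (Fin d) // y ∈ (integerLatticeConfiguration d).points ∧ y ≠ 0},
          V (dist (0 : EuclideanSpace ℝ (Fin d)) y.1))
        = ∑' y : ↥{y : EuclideanSpace ℝ (Fin d) | y ∈ (integerLatticeConfiguration d).points ∧ y ≠ 0},
            V (dist (0 : EuclideanSpace ℝ (Fin d)) y.1) := rfl
    _ = ∑' y : ↥{g : EuclideanSpace ℝ (Fin d) | g ∈ stdIntLattice d ∧ g ≠ 0},
            V (dist (0 : EuclideanSpace ℝ (Fin d)) y.1) :=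
          tsum_congr_set_coe (fun y => V (dist (0 : EuclideanSpace ℝ (Fin d)) y)) hset
    _ = ∑' g : {g : EuclideanSpace ℝ (Fin d) // g ∈ stdIntLattice d ∧ g ≠ 0}, V ‖g.1‖ := by
          refine tsum_congr fun g => ?_
          rw [dist_comm, dist_zero_right]

end IntegerLattice

/-! ## The carrier `PeriodicConfiguration d` is inhabited for every `d` -/

/-- **Periodic configurations exist in every dimension**: for every `d : ℕ` the type
`PeriodicConfiguration d` is non-empty, witnessed by the integer lattice `ℤᵈ` with motif `{0}`
(`integerLatticeConfiguration d`). Carrier witness for the libB census of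
`AtomisticToContinuum/Crystallization` (D-0034): no route item quantifying over
`PeriodicConfiguration d` is vacuous for want of an inhabitant, at any `d`. [folklore] -/
theorem PeriodicConfiguration_nonempty : ∀ d : ℕ, Nonempty (PeriodicConfiguration d) :=
  fun d => ⟨integerLatticeConfiguration d⟩

namespace PeriodicConfiguration

/-- `ℤᵈ` as the default periodic configuration of `ℝᵈ`. [folklore] -/
instance instInhabited (d : ℕ) : Inhabited (PeriodicConfiguration d) :=
  ⟨integerLatticeConfiguration d⟩

/-- `PeriodicConfiguration d` is non-empty for every `d` (registered as an instance, so that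
`⨅ Q : PeriodicConfiguration d, …`, `Classical.arbitrary` and the `ciInf` lemmas requiring
`Nonempty` apply without a local witness). [folklore] -/
instance instNonempty (d : ℕ) : Nonempty (PeriodicConfiguration d) :=
  PeriodicConfiguration_nonempty d

/-- The default configuration is `ℤᵈ`. [folklore] -/
theorem default_eq (d : ℕ) : (default : PeriodicConfiguration d) = integerLatticeConfiguration d :=
  rfl

variable {d : ℕ}

/-- The set of energies per particle of periodic configurations is non-empty (so `IsLeast`,
`BddBelow`, `sInf` statements about it are not about `∅`). [folklore] -/
theorem range_energyPerParticle_nonempty (V : ℝ → ℝ) :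
    (Set.range fun Q : PeriodicConfiguration d => Q.energyPerParticle V).Nonempty :=
  Set.range_nonempty _

/-- Typical use of the instance: a uniform lower bound on the energies per particle bounds the
infimum `⨅ Q, e(Q)` from below (`le_ciInf` needs `Nonempty`). [folklore] -/
theorem le_ciInf_energyPerParticle {V : ℝ → ℝ} {c : ℝ}
    (h : ∀ Q : PeriodicConfiguration d, c ≤ Q.energyPerParticle V) :
    c ≤ ⨅ Q : PeriodicConfiguration d, Q.energyPerParticle V :=
  le_ciInf h

/-- … and the infimum is at most the energy of `ℤᵈ` whenever the energies are bounded below.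
[folklore] -/
theorem ciInf_energyPerParticle_le_integerLattice {V : ℝ → ℝ}
    (hb : BddBelow (Set.range fun Q : PeriodicConfiguration d => Q.energyPerParticle V)) :
    ⨅ Q : PeriodicConfiguration d, Q.energyPerParticle V ≤
      (integerLatticeConfiguration d).energyPerParticle V :=
  ciInf_le hb _

end PeriodicConfiguration

end Literature.MathematicalPhysics.StatisticalMechanics

end
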